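import Summits.CriticalPhenomena.SAWScalingLimit.Theorems.SAWLoopFugacityFlowSimpleSubseqLimitsFirstHitPassage
import Summits.CriticalPhenomena.SAWScalingLimit.Theorems.SAWLoopFugacityFlowSimpleSubseqLimitsPSLine
import HarnessLib

/-!
# First-hit typing of the ORDER residual — the line and its pins
(crux stmt-CriticalPhenomena-4982, decl `Summit.CriticalPhenomena.SAWScalingLimit.Theses.SAWLoopFugacityFlow.SimpleSubseqLimits`;
line lead c2, 2026-08-16)

§1 THE LINE.  `line_firstHit : FirstHitDecay → AvoidanceLimit → AvoidancePassage → SLEAvoidanceValue →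
SimpleSubseqLimits`: SIMPLICITY of every subsequential weak limit comes from the first-hit input ALONE
(`FirstHit.Passage.ae_simple_of_firstHitDecayAt`: open-set portmanteau + Rohde–Schramm one level down,
`FirstHitFlat`), the BOUNDARY clause from SHAPE (`PastShadowing.Main.rangeArc_of_avoidanceValues`, fed by
the three route items through `avoidanceValues_of_routeItems`), endpoints and confinement are free
(`Negative.simpleSubseqLimits_iff_core`).  Route-neutral form over `AvoidanceValues`:
`simpleSubseqLimits_of_firstHitDecay_of_avoidanceValues`.

§2 THE PINS.  `firstHitDecay_of_sawScalingLimit : SAWScalingLimit → FirstHitDecay` (the input is not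
over-strong) and `firstHitDecay_of_crux : EventualTight → SimpleSubseqLimits → FirstHitDecay` (it is
NECESSARY for the crux given tightness), both from the landed necessity principle for closed antitone
thickenings (`Negative.exists_limsup_law_le_of_{sawScalingLimit,crux}_of_not_simple`, p84995) applied to
`F n = closure (nearFirstHitReturnEvent q r (r + 1/(n+1)) ρ (1/(n+1)))`, whose intersection contains no
SIMPLE class (`not_mem_closure_nearFirstHitReturnEvent_forall_of_simple`: sup-close representatives carry
data `vₙ < Tₙ ≤ t'ₙ` with `ρ < |γₙ vₙ − γₙ Tₙ|` and `|γₙ t'ₙ − γₙ vₙ| < 1/(n+1)`; along a subsequence the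
limits satisfy `e t₁ = e v₁`, so `t₁ = v₁` by injectivity and `T₁ = v₁`, forcing `ρ ≤ 0`).
Hence `crux_iff_firstHitDecay : EventualTight → A-side → (SimpleSubseqLimits ↔ FirstHitDecay)`: the
first-hit input, like the shadow input (`PastShadowing.Main.crux_iff_shadowDecay`), is the crux re-expressed
on the lattice — here at a single stopping time (first entrance into a closed ball), the form in which an
engine delivering boundary-avoidance VALUES of the critical SAW uniformly over slit domains would prove it.
-/

noncomputable section

open MeasureTheory Filter Topology Set Metric Function
open Literature.Probability.RandomPlanarGeometry Literature.Probability.RandomPlanarGeometry.SAW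
open Literature.Probability.LatticeModels
open scoped ENNReal NNReal BoundedContinuousFunction unitInterval

namespace Summit.CriticalPhenomena.SAWScalingLimit.Theorems.SimpleSubseqLimits.FirstHit.Line

open Summit.CriticalPhenomena.SAWScalingLimit.Theses.SAWLoopFugacityFlow
  (SimpleSubseqLimits AvoidanceLimit AvoidancePassage SLEAvoidanceValue EventualTight)
open Summit.CriticalPhenomena.SAWScalingLimit.Theorems.SimpleSubseqLimits.Negative
  (simpleSubseqLimits_iff_core exists_limsup_law_le_of_sawScalingLimit_of_not_simple
    exists_limsup_law_le_of_crux_of_not_simple)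
open Summit.CriticalPhenomena.SAWScalingLimit.Theorems.SimpleSubseqLimits.FirstHit.Passage
  (NearFirstHitReturn nearFirstHitReturnEvent FirstHitDecayAt FirstHitDecay ae_simple_of_firstHitDecayAt)
open Summit.CriticalPhenomena.SAWScalingLimit.Theorems.SimpleSubseqLimits.PastShadowing.Main
  (AvoidanceValues rangeArc_of_avoidanceValues avoidanceValues_of_routeItems)

/-! ## §1 The line: crux ⇐ first-hit decay ∧ A-side -/

/-- **Route-neutral composition.** First-hit decay (ORDER, first-hit typing) and the hull-avoidance
values of subsequential limits (SHAPE) give the crux: `ν`-a.s. simple by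
`FirstHit.Passage.ae_simple_of_firstHitDecayAt`, the boundary clause `range ∩ ∂D ⊆ {a, b}` by
`PastShadowing.Main.rangeArc_of_avoidanceValues`, the rest is free (`Negative.simpleSubseqLimits_iff_core`).
[folklore] -/
theorem simpleSubseqLimits_of_firstHitDecay_of_avoidanceValues (hF : FirstHitDecay)
    (hAV : AvoidanceValues) : SimpleSubseqLimits := by
  refine simpleSubseqLimits_iff_core.2 fun D a b hab s ν hs hν hw => ?_
  have hra := rangeArc_of_avoidanceValues hAV D a b hab s ν hs hν hw
  have hsimple := ae_simple_of_firstHitDecayAt hab (hF D a b hab) ⟨hs, hν, hw⟩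
  filter_upwards [hra, hsimple] with c hc hsc
  exact ⟨hsc, hc.2⟩

/-- **THE FIRST-HIT LINE** for the crux `SimpleSubseqLimits` in route SAWLoopFugacityFlow /
SAWSteinDefect: from the first-hit lattice input and the three route items `AvoidanceLimit`
(stmt-10649), `AvoidancePassage` (stmt-4984), `SLEAvoidanceValue` (stmt-10651). [folklore] -/
theorem line_firstHit : FirstHitDecay → AvoidanceLimit → AvoidancePassage → SLEAvoidanceValue →
    SimpleSubseqLimits :=
  fun hF hA hP hV =>
    simpleSubseqLimits_of_firstHitDecay_of_avoidanceValues hF (avoidanceValues_of_routeItems hA hP hV)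

/-! ## §2 The pins: `FirstHitDecay` is summit-implied and necessary given tightness -/

/-- Near first-hit returns are invariant under reparametrisation (order/metric statements on the
values). [folklore] -/
theorem nearFirstHitReturn_reparam {γ : Curve ℂ} {q : ℂ} {r r' ρ ε : ℝ}
    (h : NearFirstHitReturn γ q r r' ρ ε) (φ : I ≃o I) :
    NearFirstHitReturn (γ.reparam φ) q r r' ρ ε := by
  obtain ⟨v, T, t', hvT, hTt, hpast, hT, hρ, hret⟩ := h
  refine ⟨φ.symm v, φ.symm T, φ.symm t', φ.symm.strictMono hvT, φ.symm.monotone hTt, ?_, ?_, ?_, ?_⟩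
  · intro u hu
    have h1 : φ u ≤ v := by simpa using φ.monotone hu
    show r < dist (γ (φ u)) q
    exact hpast (φ u) h1
  · show dist (γ (φ (φ.symm T))) q < r'
    rw [φ.apply_symm_apply]; exact hT
  · show ρ < dist (γ (φ (φ.symm v))) (γ (φ (φ.symm T)))
    rw [φ.apply_symm_apply, φ.apply_symm_apply]; exact hρ
  · show dist (γ (φ (φ.symm t'))) (γ (φ (φ.symm v))) < ε
    rw [φ.apply_symm_apply, φ.apply_symm_apply]; exact hret

/-- Near first-hit returns are monotone in the outer radius `r'` and the width `ε`. [folklore] -/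
theorem nearFirstHitReturn_mono {γ : Curve ℂ} {q : ℂ} {r r' r'' ρ ε ε' : ℝ}
    (h : NearFirstHitReturn γ q r r' ρ ε) (hr : r' ≤ r'') (hε : ε ≤ ε') :
    NearFirstHitReturn γ q r r'' ρ ε' := by
  obtain ⟨v, T, t', hvT, hTt, hpast, hT, hρ, hret⟩ := h
  exact ⟨v, T, t', hvT, hTt, hpast, hT.trans_le hr, hρ, hret.trans_le hε⟩

/-- **Core.** For `ρ > 0`, a SIMPLE class cannot lie in
`closure (nearFirstHitReturnEvent q r (r + 1/(n+1)) ρ (1/(n+1)))` for every `n`: sup-close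
representatives `γₙ` of the injective `e` carry data `vₙ < Tₙ ≤ t'ₙ` with `ρ < |γₙ vₙ − γₙ Tₙ|` and
`|γₙ t'ₙ − γₙ vₙ| < 1/(n+1)`; along a subsequence `(vₙ, Tₙ, t'ₙ) → (v₁, T₁, t₁)` with `e t₁ = e v₁`, so
`t₁ = v₁` by injectivity, hence `T₁ = v₁`, and `ρ ≤ |e v₁ − e T₁| = 0`. [folklore] -/
theorem not_mem_closure_nearFirstHitReturnEvent_forall_of_simple {q : ℂ} {r ρ : ℝ} (hρ : 0 < ρ)
    {c : CurveClass ℂ} (hc : c ∈ CurveClass.simple)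
    (h : ∀ n : ℕ, c ∈ closure
      (nearFirstHitReturnEvent q r (r + 1 / ((n : ℝ) + 1)) ρ (1 / ((n : ℝ) + 1)))) : False := by
  obtain ⟨e, he, rfl⟩ := hc
  have hex : ∀ n : ℕ, ∃ γ : Curve ℂ,
      NearFirstHitReturn γ q r (r + 1 / ((n : ℝ) + 1)) ρ (1 / ((n : ℝ) + 1)) ∧
        ∀ t, dist (e t) (γ t) < 1 / ((n : ℝ) + 1) := by
    intro n
    obtain ⟨b, hb, hd⟩ :=
      Metric.mem_closure_iff.1 (h n) _ (by positivity : (0 : ℝ) < 1 / ((n : ℝ) + 1))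
    obtain ⟨γ, rfl, hγ⟩ := hb
    change dist (SeparationQuotient.mk e) (SeparationQuotient.mk γ) < _ at hd
    rw [SeparationQuotient.dist_mk] at hd
    obtain ⟨φ, hφ⟩ := Curve.exists_dist_reparam_lt hd
    exact ⟨γ.reparam φ, nearFirstHitReturn_reparam hγ φ,
      fun t => (ContinuousMap.dist_apply_le_dist t).trans_lt hφ⟩
  choose γ hγ hclose using hex
  choose v T t' hvT hTt _hpast _hT hρfar hret using hγ
  obtain ⟨⟨v₁, T₁, t₁⟩, ψ, hψ, hlim⟩ :=
    CompactSpace.tendsto_subseq (fun n => (v n, T n, t' n))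
  have hvl : Tendsto (fun k => v (ψ k)) atTop (𝓝 v₁) :=
    (continuous_fst.tendsto _).comp hlim
  have hTl : Tendsto (fun k => T (ψ k)) atTop (𝓝 T₁) :=
    (continuous_fst.comp continuous_snd).tendsto _ |>.comp hlim
  have htl : Tendsto (fun k => t' (ψ k)) atTop (𝓝 t₁) :=
    (continuous_snd.comp continuous_snd).tendsto _ |>.comp hlim
  have herr : Tendsto (fun k : ℕ => 1 / ((ψ k : ℝ) + 1)) atTop (𝓝 0) := by
    have h1 : Tendsto (fun k : ℕ => 1 / ((k : ℝ) + 1)) atTop (𝓝 0) :=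
      tendsto_one_div_add_atTop_nhds_zero_nat
    refine squeeze_zero (fun k => by positivity) (fun k => ?_) h1
    have : (k : ℝ) ≤ ψ k := by exact_mod_cast hψ.id_le k
    exact one_div_le_one_div_of_le (by positivity) (by linarith)
  have hval : ∀ {u : ℕ → I} {u₀ : I}, Tendsto (fun k => u (ψ k)) atTop (𝓝 u₀) →
      Tendsto (fun k => γ (ψ k) (u (ψ k))) atTop (𝓝 (e u₀)) := by
    intro u u₀ hu
    rw [tendsto_iff_dist_tendsto_zero]
    have h2 : Tendsto (fun k => dist (e (u (ψ k))) (e u₀)) atTop (𝓝 0) := by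
      rw [← tendsto_iff_dist_tendsto_zero]
      exact (e.continuous.tendsto u₀).comp hu
    refine squeeze_zero (fun k => dist_nonneg) (fun k => ?_)
      (by simpa only [add_zero] using herr.add h2)
    calc dist (γ (ψ k) (u (ψ k))) (e u₀)
        ≤ dist (γ (ψ k) (u (ψ k))) (e (u (ψ k))) + dist (e (u (ψ k))) (e u₀) := dist_triangle _ _ _
      _ ≤ 1 / ((ψ k : ℝ) + 1) + dist (e (u (ψ k))) (e u₀) := by
          gcongr; rw [dist_comm]; exact (hclose (ψ k) _).le
  have hvv := hval hvl
  have hvT' := hval hTl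
  have hvt := hval htl
  have hfar' : ρ ≤ dist (e v₁) (e T₁) :=
    ge_of_tendsto' (hvv.dist hvT') fun k => (hρfar (ψ k)).le
  have heq : e t₁ = e v₁ := by
    have hh1 : Tendsto (fun k => dist (γ (ψ k) (t' (ψ k))) (γ (ψ k) (v (ψ k)))) atTop
        (𝓝 (dist (e t₁) (e v₁))) := hvt.dist hvv
    have hh2 : Tendsto (fun k => dist (γ (ψ k) (t' (ψ k))) (γ (ψ k) (v (ψ k)))) atTop (𝓝 0) :=
      squeeze_zero (fun k => dist_nonneg) (fun k => (hret (ψ k)).le) herr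
    exact dist_eq_zero.1 (tendsto_nhds_unique hh1 hh2)
  have h1 : v₁ ≤ T₁ := le_of_tendsto_of_tendsto' hvl hTl fun k => (hvT (ψ k)).le
  have h2 : T₁ ≤ t₁ := le_of_tendsto_of_tendsto' hTl htl fun k => hTt (ψ k)
  have h3 : t₁ = v₁ := he heq
  have h4 : T₁ = v₁ := le_antisymm (h3 ▸ h2) h1
  rw [h4, dist_self] at hfar'
  exact absurd hfar' (not_le.2 hρ)

/-- The closed `1/(n+1)`-thickenings
`n ↦ closure (nearFirstHitReturnEvent q r (r + 1/(n+1)) ρ (1/(n+1)))` of the first-hit return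
configuration at `(q, r, ρ)` decrease in `n` (monotonicity in the outer radius and the width).
[folklore] -/
theorem antitone_thick (q : ℂ) (r ρ : ℝ) :
    Antitone fun n : ℕ =>
      closure (nearFirstHitReturnEvent q r (r + 1 / ((n : ℝ) + 1)) ρ (1 / ((n : ℝ) + 1))) := by
  intro m n hmn
  have hmn' : (m : ℝ) ≤ n := by exact_mod_cast hmn
  have hle : 1 / ((n : ℝ) + 1) ≤ 1 / ((m : ℝ) + 1) :=
    one_div_le_one_div_of_le (by positivity) (by linarith)
  refine closure_mono ?_
  rintro c ⟨γ, rfl, hγ⟩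
  exact ⟨γ, rfl, nearFirstHitReturn_mono hγ (by linarith) hle⟩

/-- The intersection of the closed thickenings contains no simple class (`ρ > 0`). [folklore] -/
theorem thick_core {q : ℂ} {r ρ : ℝ} (hρ : 0 < ρ) (c : CurveClass ℂ)
    (hc : ∀ n : ℕ, c ∈
      closure (nearFirstHitReturnEvent q r (r + 1 / ((n : ℝ) + 1)) ρ (1 / ((n : ℝ) + 1)))) :
    c ∉ CurveClass.simple := fun hs =>
  not_mem_closure_nearFirstHitReturnEvent_forall_of_simple hρ hs hc

/-- **`FirstHitDecay` from any necessity principle for closed antitone thickenings with simple-free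
core** (the common shape of the two landed principles): at `(q, r, ρ, θ)` the principle gives `n` with
`limsup_δ P_δ[curve ∈ thick n] ≤ θ/2 < θ`, hence eventually
`P_δ[curve ∈ nearFirstHitReturnEvent q r (r + 1/(n+1)) ρ (1/(n+1))] ≤ θ`; take `ε = 1/(n+1)`,
`r' = r + 1/(n+1)`. [folklore] -/
theorem firstHitDecay_of_principle
    (Hp : ∀ (D : DobrushinDomain) (a b : ℝ → Site 2), IsEndpointApprox D a b →
      ∀ {F : ℕ → Set (CurveClass ℂ)}, (∀ n, IsClosed (F n)) → Antitone F →
        (∀ c : CurveClass ℂ, (∀ n, c ∈ F n) → c ∉ CurveClass.simple) → ∀ {θ : ℝ≥0∞}, 0 < θ →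
          ∃ n, limsup (fun δ => law D.carrier δ (a δ) (b δ) {γ | γ.curve ∈ F n}) (𝓝[>] (0 : ℝ)) ≤ θ) :
    FirstHitDecay := by
  intro D a b hab q r ρ θ _hr hρ hθ
  have hθ' : (0 : ℝ≥0∞) < ENNReal.ofReal θ / 2 :=
    ENNReal.half_pos (ENNReal.ofReal_pos.2 hθ).ne'
  obtain ⟨n, hn⟩ := Hp D a b hab
    (F := fun n : ℕ => closure (nearFirstHitReturnEvent q r (r + 1 / ((n : ℝ) + 1)) ρ (1 / ((n : ℝ) + 1))))
    (fun _ => isClosed_closure) (antitone_thick q r ρ) (thick_core hρ) hθ'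
  refine ⟨1 / ((n : ℝ) + 1), r + 1 / ((n : ℝ) + 1), by positivity, by linarith [(by positivity :
    (0 : ℝ) < 1 / ((n : ℝ) + 1))], ?_⟩
  have hle : limsup (fun δ => law D.carrier δ (a δ) (b δ)
      {γ | γ.curve ∈ nearFirstHitReturnEvent q r (r + 1 / ((n : ℝ) + 1)) ρ (1 / ((n : ℝ) + 1))})
        (𝓝[>] (0 : ℝ)) ≤ ENNReal.ofReal θ / 2 := by
    refine le_trans (Filter.limsup_le_limsup (Eventually.of_forall fun δ => ?_)) hn
    exact measure_mono fun γ hγ => subset_closure hγ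
  have hlt : limsup (fun δ => law D.carrier δ (a δ) (b δ)
      {γ | γ.curve ∈ nearFirstHitReturnEvent q r (r + 1 / ((n : ℝ) + 1)) ρ (1 / ((n : ℝ) + 1))})
        (𝓝[>] (0 : ℝ)) < ENNReal.ofReal θ :=
    hle.trans_lt (ENNReal.half_lt_self (ENNReal.ofReal_pos.2 hθ).ne' ENNReal.ofReal_ne_top)
  filter_upwards [Filter.eventually_lt_of_limsup_lt hlt] with δ hδ using hδ.le

/-- **`FirstHitDecay` is implied by the summit conjecture** `SAWScalingLimit` (the first-hit input is
not over-strong in truth value). [folklore] -/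
theorem firstHitDecay_of_sawScalingLimit (h : _root_.SAWScalingLimit) : FirstHitDecay :=
  firstHitDecay_of_principle fun _ _ _ hab _ hF hanti hcore _ hθ =>
    exists_limsup_law_le_of_sawScalingLimit_of_not_simple h hab hF hanti hcore hθ

/-- **`FirstHitDecay` is NECESSARY for the crux given `EventualTight`** (no proof of the crux under
tightness avoids proving it). [folklore] -/
theorem firstHitDecay_of_crux (hT : EventualTight) (hS : SimpleSubseqLimits) : FirstHitDecay :=
  firstHitDecay_of_principle fun _ _ _ hab _ hF hanti hcore _ hθ =>
    exists_limsup_law_le_of_crux_of_not_simple hT hS hab hF hanti hcore hθ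

/-- **Equivalence.** Under `EventualTight` (stmt-1372) and the three route items, the crux IS first-hit
decay: `SimpleSubseqLimits ↔ FirstHitDecay` (cf. `PastShadowing.Main.crux_iff_shadowDecay` for the
shadow typing). [folklore] -/
theorem crux_iff_firstHitDecay (hT : EventualTight) (hA : AvoidanceLimit) (hP : AvoidancePassage)
    (hV : SLEAvoidanceValue) : SimpleSubseqLimits ↔ FirstHitDecay :=
  ⟨fun hS => firstHitDecay_of_crux hT hS, fun hF => line_firstHit hF hA hP hV⟩

/-- **The two lattice typings agree in truth value** under `EventualTight` and the A-side:
`FirstHitDecay ↔ ShadowDecay` (both are the crux). [folklore] -/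
theorem firstHitDecay_iff_shadowDecay (hT : EventualTight) (hA : AvoidanceLimit) (hP : AvoidancePassage)
    (hV : SLEAvoidanceValue) :
    FirstHitDecay ↔
      Summit.CriticalPhenomena.SAWScalingLimit.Theorems.SimpleSubseqLimits.PastShadowing.ShadowDecayPinned.ShadowDecay :=
  (crux_iff_firstHitDecay hT hA hP hV).symm.trans
    (Summit.CriticalPhenomena.SAWScalingLimit.Theorems.SimpleSubseqLimits.PastShadowing.Main.crux_iff_shadowDecay
      hT hA hP hV)

/-- **Registered form (stub `stub_firstHitLine` of the crux item stmt-CriticalPhenomena-4982).** The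
first-hit line: the crux from the first-hit lattice input and the three route items. [folklore] -/
theorem stub_firstHitLine : FirstHitDecay → AvoidanceLimit → AvoidancePassage → SLEAvoidanceValue → SimpleSubseqLimits :=
  line_firstHit

end Summit.CriticalPhenomena.SAWScalingLimit.Theorems.SimpleSubseqLimits.FirstHit.Line

end
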